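import Summits.QuantumFields.YangMills.Theorems.LuscherReductionTwistedTraceScalingValleySkeleton
import Summits.QuantumFields.YangMills.Theorems.LuscherReductionTwistedTraceScalingToronLinkSpectrum
import Summits.QuantumFields.YangMills.Theorems.LuscherReductionTwistedTraceScalingToronOrbitSpectrum
import HarnessLib

/-!
# Frame-free bookkeeping for `zpeSum`: gauge invariance, value on the flat family, global Lipschitz and size bounds
# (lane A of S-BASE, crux `TwistedTraceScaling` stmt-QuantumFields-20203; bricks for BOTH clauses of the BO sub-target `ValleyBOWeakAt`, design note
# `pub/ym-fleet/ym-luscher-20007-p1/COARSE-DESIGN.md` §16–§17)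

`zpeSum L κ U = Σ_{i<3|E|} modeZPE(κσᵢ(D_U)²)` (`…ValleySkeleton`) is the `U`-dependence of lane B's super-solution bound (`…RiccatiZPE`).  Here:
* `abs_zpeSum_sub_le` — GLOBAL LIPSCHITZ: `‖D_U x − D_{U'} x‖ ≤ c‖x‖ ∀x ⇒ |zpeSum κ U − zpeSum κ U'| ≤ 3|E|·√(κ/2)·c`;
* `zpeSum_gaugeTransform` — gauge invariance; `zpeSum_abelianCfg` — `zpeSum κ V_θ = 2·toronZPE κ 0 0 + 4·toronZPE κ 0 (2θ)`; `zpeSum_abelianCfg_zero` — `= 6·toronZPE κ 0 0`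
  at the vacuum (the FLOOR constant of `ValleyBO(Weak)At`);
* `zpeSum_le_card_mul` — SIZE: `zpeSum κ U ≤ 3|E|·modeZPE(κ·(10√N)²)` uniformly in `U` (`‖D_U‖ ≤ 10√N`, `…CovariantCurlLipschitz`) — what the far-tail absorption needs;
* `zpeSum_le_vacuum_add_of_near`, `zpeSum_step_vacuum_le` — near the vacuum orbit the sum is `≤ 6·toronZPE κ 0 0 + 3|E|√(κ/2)·c` (resp. `c = 504τ√N` for a kinetic
  step of size `τ` off `g·V_0`) — what the k = 0 floor (C3d) needs.
HONEST FRAMING: fixed-lattice bookkeeping for a stub lane of a child of the CONDITIONAL reduction route (femto rung R2b1); not infinite volume, not a gap, not Clay.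
-/

set_option autoImplicit false

noncomputable section

open MeasureTheory Real Module Finset
open scoped BigOperators RealInnerProductSpace
open Literature.MathematicalPhysics.QuantumFieldTheory
open Literature.MathematicalPhysics.QuantumLattice

namespace Summit.QuantumFields.YangMills.Theorems.FemtoTransferGap

open TwoLattice TwoLattice.Toron TwoLattice.Cov TwoLattice.Stiff

variable {L : ℕ} [NeZero L]

/-! ## §1 Global Lipschitz, gauge invariance, the flat family -/

/-- ★ **Global Lipschitz bound**: `‖D_U x − D_{U'} x‖ ≤ c‖x‖` for all `x` implies `|zpeSum κ U − zpeSum κ U'| ≤ 3|E|·√(κ/2)·c` (Weyl–Mirsky + `arsinh`).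
[cite: HornJohnson2013, Cor 7.3.5] -/
theorem abs_zpeSum_sub_le (U U' : GaugeConfig 3 L SU2) {κ c : ℝ} (hκ : 0 ≤ κ) (hc0 : 0 ≤ c) (hc : ∀ x, ‖covCurl U x - covCurl U' x‖ ≤ c * ‖x‖) :
    |zpeSum L κ U - zpeSum L κ U'| ≤ (Fintype.card (Edge 3 L) * 3 : ℕ) * (Real.sqrt (κ / 2) * c) :=
  abs_sum_modeZPE_singularValues_sub_le (covCurl U) (covCurl U') hκ hc0 hc _

/-- **Gauge invariance** of `zpeSum`. [cite: Luscher1983, §3] -/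
theorem zpeSum_gaugeTransform (g : Site 3 L → SU2) (U : GaugeConfig 3 L SU2) (κ : ℝ) : zpeSum L κ (gaugeTransform g U) = zpeSum L κ U := by
  classical
  have h := Frame.isDiag_eigenvectorBasis (covCurl U) (finrank_linkSpace L)
  rw [← sum_modeZPE_eq_zpeSum L h κ, ← sum_modeZPE_eq_zpeSum L (h.rotate L g) κ]

/-- **On the flat family**: `zpeSum κ V_θ = 2·toronZPE κ 0 0 + 4·toronZPE κ 0 (2θ)` (neutral + charged adjoint modes). [cite: Luscher1983, §3] -/
theorem zpeSum_abelianCfg (θ : Fin 3 → ℝ) (κ : ℝ) :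
    zpeSum L κ (abelianCfg L θ) = 2 * toronZPE L κ 0 0 + 4 * toronZPE L κ 0 (fun k => 2 * θ k) := by
  classical
  rw [← sum_modeZPE_eq_zpeSum L (Frame.isDiag_eigenvectorBasis (covCurl (abelianCfg L θ)) (finrank_linkSpace L)) κ]
  exact sum_modeZPE_eigenvalues_covHessian_abelianCfg L θ (finrank_linkSpace L) κ

/-- **At the vacuum**: `zpeSum κ V_0 = 6·toronZPE κ 0 0` — the FLOOR constant of `ValleyBO(Weak)At`. [cite: Luscher1983, §3] -/
theorem zpeSum_abelianCfg_zero (κ : ℝ) : zpeSum L κ (abelianCfg L 0) = 6 * toronZPE L κ 0 0 := by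
  rw [zpeSum_abelianCfg]
  have h : (fun k : Fin 3 => 2 * (0 : Fin 3 → ℝ) k) = 0 := by funext k; simp
  rw [h]; ring

/-- Every gauge copy of the vacuum has `zpeSum = 6·toronZPE κ 0 0`. [cite: Luscher1983, §3] -/
theorem zpeSum_gaugeTransform_abelianCfg_zero (g : Site 3 L → SU2) (κ : ℝ) :
    zpeSum L κ (gaugeTransform g (abelianCfg L 0)) = 6 * toronZPE L κ 0 0 := by
  rw [zpeSum_gaugeTransform, zpeSum_abelianCfg_zero]

/-! ## §2 Size bound -/

/-- In a diagonalising frame the values are `aᵢ = ‖D eᵢ‖²`. [folklore] -/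
theorem Frame.IsDiag.value_eq_norm_sq {ι : Type*} [Fintype ι] [DecidableEq ι] {U : GaugeConfig 3 L SU2} {e : OrthonormalBasis ι ℝ (LinkSpace L)}
    {a : ι → ℝ} (h : Frame.IsDiag (covCurl U) e a) (i : ι) : a i = ‖covCurl U (e i)‖ ^ 2 := by
  have h1 := h i i
  simp only [if_true] at h1
  rw [← real_inner_self_eq_norm_sq]
  exact_mod_cast h1.symm

/-- ★ **Uniform size bound**: `zpeSum κ U ≤ 3|E|·modeZPE(κ·(10√N)²)` for every `U` (`N = 3|P|`; `‖D_U‖ ≤ 10√N`). [cite: Luscher1983, §3] -/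
theorem zpeSum_le_card_mul (U : GaugeConfig 3 L SU2) {κ : ℝ} (hκ : 0 ≤ κ) :
    zpeSum L κ U ≤ (Fintype.card (Edge 3 L) * 3 : ℕ) * modeZPE (κ * (10 * Real.sqrt (Fintype.card (Plaquette 3 L × Fin 3))) ^ 2) := by
  classical
  have h := Frame.isDiag_eigenvectorBasis (covCurl U) (finrank_linkSpace L)
  rw [← sum_modeZPE_eq_zpeSum L h κ]
  set M : ℝ := 10 * Real.sqrt (Fintype.card (Plaquette 3 L × Fin 3)) with hM
  have hle : ∀ i, modeZPE (κ * (LinearMap.isPositive_adjoint_comp_self (covCurl U)).isSymmetric.eigenvalues (finrank_linkSpace L) i) ≤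
      modeZPE (κ * M ^ 2) := fun i => by
    have hv := Frame.IsDiag.value_eq_norm_sq h i
    have hn := norm_covCurl_le_op U
      ((LinearMap.isPositive_adjoint_comp_self (covCurl U)).isSymmetric.eigenvectorBasis (finrank_linkSpace L) i)
    rw [((LinearMap.isPositive_adjoint_comp_self (covCurl U)).isSymmetric.eigenvectorBasis (finrank_linkSpace L)).orthonormal.1 i,
      mul_one] at hn
    have h0 : 0 ≤ ‖covCurl U ((LinearMap.isPositive_adjoint_comp_self (covCurl U)).isSymmetric.eigenvectorBasis (finrank_linkSpace L) i)‖ :=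
      norm_nonneg _
    refine modeZPE_le_modeZPE (mul_nonneg hκ (h.nonneg i)) (mul_le_mul_of_nonneg_left ?_ hκ)
    rw [hv]
    exact pow_le_pow_left₀ h0 hn 2
  calc ∑ i, modeZPE (κ * (LinearMap.isPositive_adjoint_comp_self (covCurl U)).isSymmetric.eigenvalues (finrank_linkSpace L) i)
      ≤ ∑ _i : Fin (Fintype.card (Edge 3 L) * 3), modeZPE (κ * M ^ 2) := sum_le_sum fun i _ => hle i
    _ = (Fintype.card (Edge 3 L) * 3 : ℕ) * modeZPE (κ * M ^ 2) := by rw [sum_const, card_univ, Fintype.card_fin, nsmul_eq_mul]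

/-! ## §3 Near the vacuum orbit -/

/-- ★ **Near a gauge copy of the vacuum**: `‖D_U x − D_{g·V_0} x‖ ≤ c‖x‖ ∀x ⇒ zpeSum κ U ≤ 6·toronZPE κ 0 0 + 3|E|·√(κ/2)·c`. [cite: Luscher1983, §3] -/
theorem zpeSum_le_vacuum_add_of_near (U : GaugeConfig 3 L SU2) (g : Site 3 L → SU2) {κ c : ℝ} (hκ : 0 ≤ κ) (hc0 : 0 ≤ c)
    (hc : ∀ x, ‖covCurl U x - covCurl (gaugeTransform g (abelianCfg L 0)) x‖ ≤ c * ‖x‖) :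
    zpeSum L κ U ≤ 6 * toronZPE L κ 0 0 + (Fintype.card (Edge 3 L) * 3 : ℕ) * (Real.sqrt (κ / 2) * c) := by
  have h := abs_zpeSum_sub_le U (gaugeTransform g (abelianCfg L 0)) hκ hc0 hc
  rw [zpeSum_gaugeTransform_abelianCfg_zero] at h
  linarith [(abs_le.1 h).2]

/-- And from below: `zpeSum κ U ≥ 6·toronZPE κ 0 0 − 3|E|·√(κ/2)·c`. [cite: Luscher1983, §3] -/
theorem vacuum_sub_le_zpeSum_of_near (U : GaugeConfig 3 L SU2) (g : Site 3 L → SU2) {κ c : ℝ} (hκ : 0 ≤ κ) (hc0 : 0 ≤ c)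
    (hc : ∀ x, ‖covCurl U x - covCurl (gaugeTransform g (abelianCfg L 0)) x‖ ≤ c * ‖x‖) :
    6 * toronZPE L κ 0 0 - (Fintype.card (Edge 3 L) * 3 : ℕ) * (Real.sqrt (κ / 2) * c) ≤ zpeSum L κ U := by
  have h := abs_zpeSum_sub_le U (gaugeTransform g (abelianCfg L 0)) hκ hc0 hc
  rw [zpeSum_gaugeTransform_abelianCfg_zero] at h
  linarith [(abs_le.1 h).1]

/-- ★ **A kinetic step off the vacuum orbit**: `U = W·(g·V_0)` with `|vecPart(W_e)_c| ≤ τ ≤ 1` has `zpeSum κ U ≤ 6·toronZPE κ 0 0 + 3|E|·√(κ/2)·504τ√N`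
(lane B's `norm_covCurl_step_sub_le`). [cite: Luscher1983, §3] -/
theorem zpeSum_step_vacuum_le {W : GaugeConfig 3 L SU2} {τ : ℝ} (hτ1 : τ ≤ 1) (hw : ∀ (e : Edge 3 L) (c : Fin 3), |vecPart (W e) c| ≤ τ)
    (g : Site 3 L → SU2) {κ : ℝ} (hκ : 0 ≤ κ) :
    zpeSum L κ (W * gaugeTransform g (abelianCfg L 0)) ≤
      6 * toronZPE L κ 0 0 + (Fintype.card (Edge 3 L) * 3 : ℕ) * (Real.sqrt (κ / 2) * (504 * τ * Real.sqrt (Fintype.card (Plaquette 3 L × Fin 3)))) := by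
  have hτ0 : 0 ≤ τ := (abs_nonneg _).trans (hw default 0)
  exact zpeSum_le_vacuum_add_of_near _ g hκ (by positivity) fun v => norm_covCurl_step_sub_le (gaugeTransform g (abelianCfg L 0)) hτ1 hw v

end Summit.QuantumFields.YangMills.Theorems.FemtoTransferGap

end
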